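import Mathlib.Analysis.SpecialFunctions.JapaneseBracket
import Literature.Analysis.Fourier.SelbergMajorants
import Literature.Analysis.SpecialFunctions.DigammaVerticalSeries
import Literature.Analysis.SpecialFunctions.DigammaVerticalAsymptotics
import HarnessLib

/-!
# The archimedean integral of Selberg's functions: Goldston–Gonek's formula (2.3)

Topic `Literature/NumberTheory/LFunctions`. Everything in this file is PROVED (no definitions, no
named facts).

D. A. Goldston, S. M. Gonek, *A note on `S(t)` and the zeros of the Riemann zeta-function*,
Bull. LMS 39 (2007), eq. (2.3), as quoted by Balazard–de Roton, *Notes de lecture…*,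
arXiv:0810.3587, Prop. 12: for `t ≥ 4`, `Δ ≥ 1`, `0 < h ≤ √t` and Selberg's functions `F±` of
the interval `[−h, h]` with bandwidth `Δ`,

  `∫ F±(u − t) Re ψ(¼ + iu/2) du = (2h ± 1/Δ) log(t/2) + O(1)`.

We prove the case `0 < h ≤ 1` (the only one used downstream, in Props. 15–20 of Balazard–de
Roton, where `h = πδV/log T ≤ 1`), with an absolute constant:
`Literature.NumberTheory.LFunctions.exists_abs_integral_selbergMajorant_reDigammaQuarter_sub_le`
and `…Minorant…`. Ingredients: `∫ F± = 2h ± 1/Δ`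
(`Literature.Analysis.Fourier.integral_selbergMajorantReal`), the vertical asymptotic
`|Re ψ(¼+iu/2) − log(1+|u|/2)| ≤ C₁`
(`Literature.Analysis.SpecialFunctions.Complex.exists_norm_digamma_sub_log_le_of_pos`), the
elementary `|log x| ≤ 2√x + 2/√x` giving the `t`-free majorant
`|Re ψ(¼+iu/2) − log(t/2)| ≤ C₁ + 6 + 3√|u − t|` (`t ≥ 4`), and the decay
`|F±(v)| ≤ 6/v²` (`|v| ≥ 2`) of `SelbergMajorants.lean`.

## References

* [GoldstonGonek2007] D. A. Goldston, S. M. Gonek, Bull. LMS 39 (2007), 482–486, (2.3).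
* [BalazardDeRoton2008] M. Balazard, A. de Roton, arXiv:0810.3587, Prop. 12.
  [cite: BalazardDeRoton2008, Prop. 12]
-/

noncomputable section

open Complex Filter Set MeasureTheory Topology
open scoped Real

namespace Literature.NumberTheory.LFunctions

open Literature.Analysis.Fourier Literature.Analysis.SpecialFunctions

/-! ## Elementary majorants -/

/-- `|log x| ≤ 2√x + 2/√x` for `x > 0`. [folklore] -/
lemma abs_log_le_sqrt (x : ℝ) (hx : 0 < x) : |Real.log x| ≤ 2 * Real.sqrt x + 2 / Real.sqrt x := by
  have hs : 0 < Real.sqrt x := Real.sqrt_pos.2 hx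
  have hx' : x = Real.sqrt x ^ 2 := (Real.sq_sqrt hx.le).symm
  have hlog : Real.log x = 2 * Real.log (Real.sqrt x) := by
    conv_lhs => rw [hx', Real.log_pow]
    push_cast; ring
  rw [hlog]
  have h1 : Real.log (Real.sqrt x) ≤ Real.sqrt x - 1 := Real.log_le_sub_one_of_pos hs
  have h2 : -Real.log (Real.sqrt x) ≤ 1 / Real.sqrt x - 1 := by
    rw [← Real.log_inv]
    have := Real.log_le_sub_one_of_pos (inv_pos.2 hs)
    rwa [one_div]
  have h3 : 0 < 2 / Real.sqrt x := by positivity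
  rw [abs_le]
  constructor
  · have : 1 / Real.sqrt x * 2 = 2 / Real.sqrt x := by ring
    nlinarith
  · nlinarith

/-- The `t`-free majorant: for `t ≥ 4`, `|log((2 + |u|)/t)| ≤ 6 + 3√|u − t|`. [folklore] -/
lemma abs_log_two_add_abs_div_le {t : ℝ} (ht : 4 ≤ t) (u : ℝ) :
    |Real.log ((2 + |u|) / t)| ≤ 6 + 3 * Real.sqrt |u - t| := by
  set v := u - t with hv
  have ht0 : 0 < t := by linarith
  have hx : 0 < (2 + |u|) / t := by positivity
  refine (abs_log_le_sqrt _ hx).trans ?_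
  have hsv : 0 ≤ Real.sqrt |v| := Real.sqrt_nonneg _
  have hsv2 : Real.sqrt |v| ^ 2 = |v| := Real.sq_sqrt (abs_nonneg _)
  -- `√x ≤ 5/4 + √|v|/2`
  have hu : |u| ≤ t + |v| := by
    have : u = v + t := by rw [hv]; ring
    rw [this]
    calc |v + t| ≤ |v| + |t| := abs_add_le _ _
      _ = t + |v| := by rw [abs_of_pos ht0]; ring
  have h1 : Real.sqrt ((2 + |u|) / t) ≤ 5 / 4 + Real.sqrt |v| / 2 := by
    rw [Real.sqrt_le_left (by positivity)]
    rw [div_le_iff₀ ht0]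
    nlinarith [abs_nonneg v]
  -- `1/√x ≤ 3/2 + √|v|`
  have h2 : 2 / Real.sqrt ((2 + |u|) / t) ≤ 3 + 2 * Real.sqrt |v| := by
    have hs : 0 < Real.sqrt ((2 + |u|) / t) := Real.sqrt_pos.2 hx
    rw [div_le_iff₀ hs]
    -- it suffices that `t ≤ (3/2 + √|v|)² (2 + |u|)`, via `√x ≥ …`
    rcases le_or_gt |v| (t / 2) with hsmall | hlarge
    · -- `|u| ≥ t/2`, so `x ≥ 1/2` and `√x ≥ 1/2·√2 ≥ 2/3`
      have hu2 : t / 2 ≤ |u| := by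
        have : u = t + v := by rw [hv]; ring
        rw [this]
        have := abs_sub_abs_le_abs_sub t (-v)
        rw [sub_neg_eq_add, abs_neg, abs_of_pos ht0] at this
        linarith
      have hx2 : 4 / 9 ≤ (2 + |u|) / t := by
        rw [div_le_div_iff₀ (by norm_num) ht0]; nlinarith
      have hs23 : 2 / 3 ≤ Real.sqrt ((2 + |u|) / t) := by
        rw [show (2 / 3 : ℝ) = Real.sqrt (4 / 9) by
          rw [show (4 / 9 : ℝ) = (2 / 3) ^ 2 by norm_num, Real.sqrt_sq (by norm_num)]]
        exact Real.sqrt_le_sqrt hx2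
      nlinarith
    · -- `|v| > t/2`: `x ≥ 2/t ≥ 1/|v|`, so `√x · √|v| ≥ 1`
      have hv0 : 0 < |v| := by linarith
      have hx2 : 1 / |v| ≤ (2 + |u|) / t := by
        rw [div_le_div_iff₀ hv0 ht0]; nlinarith [abs_nonneg u]
      have hprod : 1 ≤ Real.sqrt ((2 + |u|) / t) * Real.sqrt |v| := by
        rw [← Real.sqrt_mul hx.le]
        rw [show (1 : ℝ) = Real.sqrt 1 from Real.sqrt_one.symm]
        apply Real.sqrt_le_sqrt
        calc (1 : ℝ) = 1 / |v| * |v| := by field_simp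
          _ ≤ (2 + |u|) / t * |v| := by gcongr
      nlinarith
  linarith

/-- The archimedean weight differs from `log(t/2)` by at most `C + 3√|u − t|` (`t ≥ 4`).
[folklore] -/
theorem exists_abs_reDigammaQuarter_sub_log_half_le :
    ∃ C : ℝ, 0 ≤ C ∧ ∀ t : ℝ, 4 ≤ t → ∀ u : ℝ,
      |reDigammaQuarter u - Real.log (t / 2)| ≤ C + 3 * Real.sqrt |u - t| := by
  obtain ⟨C₁, hC₁⟩ :=
    Literature.Analysis.SpecialFunctions.Complex.exists_norm_digamma_sub_log_le_of_pos
      (a := 1 / 4) (by norm_num)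
  have hC₁0 : 0 ≤ C₁ := (norm_nonneg _).trans (hC₁ 0)
  refine ⟨C₁ + 6, by linarith, fun t ht u ↦ ?_⟩
  have ht0 : 0 < t := by linarith
  -- `|ρ(u) − log(1 + |u|/2)| ≤ C₁`
  have h1 : |reDigammaQuarter u - Real.log (1 + |u| / 2)| ≤ C₁ := by
    have h := hC₁ (u / 2)
    have hw : ((1 / 4 : ℝ) : ℂ) + ((u / 2 : ℝ) : ℂ) * I = 1 / 4 + (u : ℂ) / 2 * I := by
      push_cast; ring
    rw [hw, show |u / 2| = |u| / 2 by rw [abs_div, abs_two]] at h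
    have hre : (Complex.digamma (1 / 4 + (u : ℂ) / 2 * I) - (Real.log (1 + |u| / 2) : ℂ)).re =
        reDigammaQuarter u - Real.log (1 + |u| / 2) := by
      simp only [Complex.sub_re, Complex.ofReal_re, reDigammaQuarter]
    rw [← hre]
    exact (Complex.abs_re_le_norm _).trans h
  -- `log(1 + |u|/2) − log(t/2) = log((2+|u|)/t)`
  have h2 : Real.log (1 + |u| / 2) - Real.log (t / 2) = Real.log ((2 + |u|) / t) := by
    rw [← Real.log_div (by positivity) (by positivity)]
    congr 1
    field_simp
  have h3 := abs_log_two_add_abs_div_le ht u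
  calc |reDigammaQuarter u - Real.log (t / 2)|
      = |(reDigammaQuarter u - Real.log (1 + |u| / 2)) + (Real.log (1 + |u| / 2) - Real.log (t / 2))| := by
        ring_nf
    _ ≤ |reDigammaQuarter u - Real.log (1 + |u| / 2)| + |Real.log (1 + |u| / 2) - Real.log (t / 2)| :=
        abs_add_le _ _
    _ ≤ C₁ + (6 + 3 * Real.sqrt |u - t|) := by rw [h2]; exact add_le_add h1 h3
    _ = C₁ + 6 + 3 * Real.sqrt |u - t| := by ring

/-! ## Uniform bounds for Selberg's functions on the real line -/

/-- `|F₊(v)| ≤ 3e^{2π}` on `ℝ`. [cite: BalazardDeRoton2008, Prop. 10 (iv)] -/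
lemma abs_selbergMajorantReal_le {Δ : ℝ} (hΔ : 0 < Δ) (a b v : ℝ) :
    |selbergMajorantReal Δ a b v| ≤ 3 * Real.exp (2 * π) := by
  have h := norm_selbergMajorant_le hΔ a b v
  rw [selbergMajorant_ofReal, Complex.norm_real, Real.norm_eq_abs] at h
  simpa using h

/-- `|F₋(v)| ≤ 3e^{2π}` on `ℝ`. [cite: BalazardDeRoton2008, Prop. 10 (iv)] -/
lemma abs_selbergMinorantReal_le {Δ : ℝ} (hΔ : 0 < Δ) (a b v : ℝ) :
    |selbergMinorantReal Δ a b v| ≤ 3 * Real.exp (2 * π) := by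
  have h := norm_selbergMinorant_le hΔ a b v
  rw [selbergMinorant_ofReal, Complex.norm_real, Real.norm_eq_abs] at h
  simpa using h

/-- Far-field on `ℝ` for `[−h, h]`, `h ≤ 1 ≤ Δ`: `|F₊(v)| ≤ 6/v²` for `|v| ≥ 2`.
[cite: BalazardDeRoton2008, Prop. 10 (iv)] -/
lemma abs_selbergMajorantReal_le_of_two_le {Δ h : ℝ} (hΔ : 1 ≤ Δ) (hh0 : 0 < h) (hh : h ≤ 1) {v : ℝ}
    (hv : 2 ≤ |v|) : |selbergMajorantReal Δ (-h) h v| ≤ 6 / v ^ 2 := by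
  have hΔ0 : 0 < Δ := by linarith
  have hmax : max (-h) h = h := max_eq_right (by linarith)
  have hmin : min (-h) h = -h := min_eq_left (by linarith)
  have h1Δ : 1 / Δ ≤ 1 := by rw [div_le_one hΔ0]; exact hΔ
  have hvne : v ≠ 0 := by intro h0; rw [h0, abs_zero] at hv; linarith
  have hv2pos : 0 < v ^ 2 := lt_of_le_of_ne (sq_nonneg v) (Ne.symm (pow_ne_zero 2 hvne))
  have key : ∀ d : ℝ, |v| - h ≤ d →
      3 / 2 * Real.exp (2 * π * Δ * |(0 : ℝ)|) / (Δ ^ 2 * d ^ 2) ≤ 6 / v ^ 2 := by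
    intro d hd
    have hdpos : 0 < d := by linarith
    simp only [abs_zero, mul_zero, Real.exp_zero, mul_one]
    rw [div_le_div_iff₀ (by positivity) hv2pos]
    have h3 : v ^ 2 ≤ 4 * d ^ 2 := by nlinarith [sq_abs v, abs_nonneg v]
    have h4 : 1 ≤ Δ ^ 2 := by nlinarith
    nlinarith [sq_nonneg d]
  rcases le_or_gt 0 v with hv' | hv'
  · rw [abs_of_nonneg hv'] at hv key
    have hz : max (-h) h + 1 / Δ ≤ ((v : ℂ)).re := by rw [hmax, Complex.ofReal_re]; linarith
    have hb := norm_selbergMajorant_le_of_le_re (a := -h) (b := h) hΔ0 hz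
    rw [selbergMajorant_ofReal, Complex.norm_real, Real.norm_eq_abs, hmax, Complex.ofReal_im,
      Complex.ofReal_re] at hb
    exact hb.trans (key (v - h) le_rfl)
  · rw [abs_of_neg hv'] at hv key
    have hz : ((v : ℂ)).re ≤ min (-h) h - 1 / Δ := by rw [hmin, Complex.ofReal_re]; linarith
    have hb := norm_selbergMajorant_le_of_re_le (a := -h) (b := h) hΔ0 hz
    rw [selbergMajorant_ofReal, Complex.norm_real, Real.norm_eq_abs, hmin, Complex.ofReal_im,
      Complex.ofReal_re] at hb
    exact hb.trans (key (-h - v) (by linarith))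

/-- Far-field on `ℝ` for `[−h, h]`, `h ≤ 1 ≤ Δ`: `|F₋(v)| ≤ 6/v²` for `|v| ≥ 2`.
[cite: BalazardDeRoton2008, Prop. 10 (iv)] -/
lemma abs_selbergMinorantReal_le_of_two_le {Δ h : ℝ} (hΔ : 1 ≤ Δ) (hh0 : 0 < h) (hh : h ≤ 1) {v : ℝ}
    (hv : 2 ≤ |v|) : |selbergMinorantReal Δ (-h) h v| ≤ 6 / v ^ 2 := by
  rw [selbergMinorantReal_eq_neg_selbergMajorantReal, abs_neg]
  have hΔ0 : 0 < Δ := by linarith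
  have hmax : max h (-h) = h := max_eq_left (by linarith)
  have hmin : min h (-h) = -h := min_eq_right (by linarith)
  have h1Δ : 1 / Δ ≤ 1 := by rw [div_le_one hΔ0]; exact hΔ
  have hvne : v ≠ 0 := by intro h0; rw [h0, abs_zero] at hv; linarith
  have hv2pos : 0 < v ^ 2 := lt_of_le_of_ne (sq_nonneg v) (Ne.symm (pow_ne_zero 2 hvne))
  have key : ∀ d : ℝ, |v| - h ≤ d →
      3 / 2 * Real.exp (2 * π * Δ * |(0 : ℝ)|) / (Δ ^ 2 * d ^ 2) ≤ 6 / v ^ 2 := by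
    intro d hd
    have hdpos : 0 < d := by linarith
    simp only [abs_zero, mul_zero, Real.exp_zero, mul_one]
    rw [div_le_div_iff₀ (by positivity) hv2pos]
    have h3 : v ^ 2 ≤ 4 * d ^ 2 := by nlinarith [sq_abs v, abs_nonneg v]
    have h4 : 1 ≤ Δ ^ 2 := by nlinarith
    nlinarith [sq_nonneg d]
  rcases le_or_gt 0 v with hv' | hv'
  · rw [abs_of_nonneg hv'] at hv key
    have hz : max h (-h) + 1 / Δ ≤ ((v : ℂ)).re := by rw [hmax, Complex.ofReal_re]; linarith
    have hb := norm_selbergMajorant_le_of_le_re (a := h) (b := -h) hΔ0 hz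
    rw [selbergMajorant_ofReal, Complex.norm_real, Real.norm_eq_abs, hmax, Complex.ofReal_im,
      Complex.ofReal_re] at hb
    exact hb.trans (key (v - h) le_rfl)
  · rw [abs_of_neg hv'] at hv key
    have hz : ((v : ℂ)).re ≤ min h (-h) - 1 / Δ := by rw [hmin, Complex.ofReal_re]; linarith
    have hb := norm_selbergMajorant_le_of_re_le (a := h) (b := -h) hΔ0 hz
    rw [selbergMajorant_ofReal, Complex.norm_real, Real.norm_eq_abs, hmin, Complex.ofReal_im,
      Complex.ofReal_re] at hb
    exact hb.trans (key (-h - v) (by linarith))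

/-! ## The integrable majorant `A/((1+|v|)√(1+|v|))` -/

/-- `v ↦ ((1 + |v|)√(1+|v|))⁻¹` is integrable on `ℝ` (it is `(1 + ‖v‖)^{−3/2}`). [folklore] -/
lemma integrable_inv_one_add_abs_mul_sqrt :
    Integrable fun v : ℝ ↦ ((1 + |v|) * Real.sqrt (1 + |v|))⁻¹ := by
  have h := integrable_one_add_norm (E := ℝ) (μ := volume) (r := 3 / 2) (by simp; norm_num)
  refine h.congr (Eventually.of_forall fun v ↦ ?_)
  simp only [Real.norm_eq_abs]
  have h0 : 0 < 1 + |v| := by positivity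
  rw [Real.rpow_neg h0.le, show (3 / 2 : ℝ) = 1 + 1 / 2 by norm_num, Real.rpow_add h0, Real.rpow_one,
    Real.sqrt_eq_rpow]

/-- The pointwise inequality behind the `O(1)`: for `|F(v)| ≤ min(C₀, 6/v²)`-type functions.
With `s = √|v|`: if `|v| ≤ 2` then `C₀ (C + 3s)(1+|v|)√(1+|v|) ≤ 6 C₀ (C + 5)`, and if `|v| ≥ 2`
then `6 (C + 3s)(1+|v|)√(1+|v|) ≤ 12 (C + 9) v²`. [folklore] -/
lemma majorant_pointwise {C C₀ F v : ℝ} (hC : 0 ≤ C) (hC₀ : 0 ≤ C₀) (hF : |F| ≤ C₀)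
    (hfar : 2 ≤ |v| → |F| ≤ 6 / v ^ 2) :
    |F| * (C + 3 * Real.sqrt |v|) ≤
      (6 * C₀ * (C + 5) + 12 * (C + 9)) * ((1 + |v|) * Real.sqrt (1 + |v|))⁻¹ := by
  set s := Real.sqrt |v| with hs
  set r := Real.sqrt (1 + |v|) with hr
  have hs0 : 0 ≤ s := Real.sqrt_nonneg _
  have hr0 : 0 < r := Real.sqrt_pos.2 (by positivity)
  have hs2 : s ^ 2 = |v| := Real.sq_sqrt (abs_nonneg _)
  have hr2 : r ^ 2 = 1 + |v| := Real.sq_sqrt (by positivity)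
  have hpos : 0 < (1 + |v|) * r := by positivity
  rw [← div_eq_mul_inv, le_div_iff₀ hpos]
  have hF0 : 0 ≤ |F| := abs_nonneg _
  rcases le_or_gt |v| 2 with hv | hv
  · -- near: `s ≤ 3/2`, `(1+|v|) r ≤ 6`
    have hs1 : s ≤ 3 / 2 := by nlinarith
    have hr1 : r ≤ 2 := by nlinarith
    have h1 : |F| * (C + 3 * s) ≤ C₀ * (C + 5) := by
      calc |F| * (C + 3 * s) ≤ C₀ * (C + 3 * (3 / 2)) := by gcongr
        _ ≤ C₀ * (C + 5) := by gcongr; norm_num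
    have h2 : (1 + |v|) * r ≤ 6 := by nlinarith [abs_nonneg v]
    calc |F| * (C + 3 * s) * ((1 + |v|) * r) ≤ C₀ * (C + 5) * 6 := by
          apply mul_le_mul h1 h2 hpos.le (by positivity)
      _ ≤ 6 * C₀ * (C + 5) + 12 * (C + 9) := by nlinarith
  · -- far: `|F| ≤ 6/v²`, `1 ≤ s`, `(1+|v|) r ≤ 2 |v| s`
    have hv2 := hfar hv.le
    have hs1 : 1 ≤ s := by nlinarith
    have hvpos : 0 < |v| := by linarith
    have hv2' : |F| * v ^ 2 ≤ 6 := by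
      have := mul_le_mul_of_nonneg_right hv2 (sq_nonneg v)
      rwa [div_mul_cancel₀ _ (pow_ne_zero 2 (abs_pos.1 hvpos))] at this
    -- `(1 + |v|) ≤ (3/2)|v|`, `r ≤ (5/4) s` since `r² = 1 + |v| ≤ (3/2)|v| ≤ (25/16) s²`
    have h1 : 1 + |v| ≤ 3 / 2 * |v| := by linarith
    have h2 : r ≤ 5 / 4 * s := by nlinarith
    have h3 : C + 3 * s ≤ (C + 9) * s := by nlinarith
    have hsq : v ^ 2 = |v| ^ 2 := (sq_abs v).symm
    calc |F| * (C + 3 * s) * ((1 + |v|) * r)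
        ≤ |F| * ((C + 9) * s) * ((3 / 2 * |v|) * (5 / 4 * s)) := by gcongr
      _ = (15 / 8 * (C + 9)) * (|F| * v ^ 2) := by rw [hsq, ← hs2]; ring
      _ ≤ (15 / 8 * (C + 9)) * 6 := by gcongr
      _ ≤ 6 * C₀ * (C + 5) + 12 * (C + 9) := by nlinarith

/-! ## The main estimate -/

/-- Integrability of the archimedean integrand `F(u − t) Re ψ(¼ + iu/2)` for `F` continuous and
integrable with `|F| ≤ C₀`, `|F(v)| ≤ 6/v²` (`|v| ≥ 2`), `t ≥ 4`. [folklore] -/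
theorem integrable_shift_mul_reDigammaQuarter {C₀ : ℝ} (hC₀ : 0 ≤ C₀)
    {F : ℝ → ℝ} (hFc : Continuous F) (hFi : Integrable F) (hF : ∀ v, |F v| ≤ C₀)
    (hfar : ∀ v, 2 ≤ |v| → |F v| ≤ 6 / v ^ 2) {t : ℝ} (ht : 4 ≤ t) :
    Integrable fun u : ℝ ↦ F (u - t) * reDigammaQuarter u := by
  obtain ⟨C, hC, hdig⟩ := exists_abs_reDigammaQuarter_sub_log_half_le
  set A : ℝ := 6 * C₀ * (C + 5) + 12 * (C + 9) with hA
  set w : ℝ → ℝ := fun u ↦ reDigammaQuarter u - Real.log (t / 2) with hw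
  have hmaj : ∀ u : ℝ, ‖F (u - t) * w u‖ ≤ A * ((1 + |u - t|) * Real.sqrt (1 + |u - t|))⁻¹ := by
    intro u
    rw [Real.norm_eq_abs, abs_mul]
    calc |F (u - t)| * |w u| ≤ |F (u - t)| * (C + 3 * Real.sqrt |u - t|) := by
          gcongr; exact hdig t ht u
      _ ≤ A * ((1 + |u - t|) * Real.sqrt (1 + |u - t|))⁻¹ :=
          majorant_pointwise hC hC₀ (hF _) (hfar _)
  have hint_maj : Integrable fun u : ℝ ↦ A * ((1 + |u - t|) * Real.sqrt (1 + |u - t|))⁻¹ :=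
    (integrable_inv_one_add_abs_mul_sqrt.comp_sub_right t).const_mul A
  have hcontw : Continuous w := continuous_reDigammaQuarter.sub continuous_const
  have hint1 : Integrable fun u : ℝ ↦ F (u - t) * w u :=
    Integrable.mono' hint_maj ((hFc.comp (continuous_id.sub continuous_const)).mul hcontw).aestronglyMeasurable
      (Eventually.of_forall hmaj)
  have hint2 : Integrable fun u : ℝ ↦ F (u - t) := hFi.comp_sub_right t
  have h := hint1.add (hint2.mul_const (Real.log (t / 2)))
  refine h.congr (Eventually.of_forall fun u ↦ ?_)
  simp only [hw, Pi.add_apply]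
  ring

/-- The archimedean integrand of `F±(· − t)` is integrable (`0 < h ≤ 1 ≤ Δ`, `t ≥ 4`).
[cite: BalazardDeRoton2008, Prop. 12] -/
theorem integrable_selbergMajorant_shift_mul_reDigammaQuarter {Δ t h : ℝ} (hΔ : 1 ≤ Δ) (ht : 4 ≤ t)
    (hh0 : 0 < h) (hh1 : h ≤ 1) :
    Integrable fun u : ℝ ↦ selbergMajorantReal Δ (-h) h (u - t) * reDigammaQuarter u := by
  have hΔ0 : 0 < Δ := by linarith
  exact integrable_shift_mul_reDigammaQuarter (C₀ := 3 * Real.exp (2 * π)) (by positivity)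
    (continuous_selbergMajorantReal Δ (-h) h) (integrable_selbergMajorantReal hΔ0 (by linarith))
    (fun v ↦ abs_selbergMajorantReal_le hΔ0 _ _ v)
    (fun v hv ↦ abs_selbergMajorantReal_le_of_two_le hΔ hh0 hh1 hv) ht

/-- The archimedean integrand of `F₋(· − t)` is integrable (`0 < h ≤ 1 ≤ Δ`, `t ≥ 4`).
[cite: BalazardDeRoton2008, Prop. 12] -/
theorem integrable_selbergMinorant_shift_mul_reDigammaQuarter {Δ t h : ℝ} (hΔ : 1 ≤ Δ) (ht : 4 ≤ t)
    (hh0 : 0 < h) (hh1 : h ≤ 1) :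
    Integrable fun u : ℝ ↦ selbergMinorantReal Δ (-h) h (u - t) * reDigammaQuarter u := by
  have hΔ0 : 0 < Δ := by linarith
  exact integrable_shift_mul_reDigammaQuarter (C₀ := 3 * Real.exp (2 * π)) (by positivity)
    (continuous_selbergMinorantReal Δ (-h) h) (integrable_selbergMinorantReal hΔ0 (by linarith))
    (fun v ↦ abs_selbergMinorantReal_le hΔ0 _ _ v)
    (fun v hv ↦ abs_selbergMinorantReal_le_of_two_le hΔ hh0 hh1 hv) ht

/-- Core of Goldston–Gonek (2.3): if `F : ℝ → ℝ` is continuous, `|F| ≤ C₀`, `|F(v)| ≤ 6/v²` for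
`|v| ≥ 2`, and `∫ F = m`, then `|∫ F(u − t) Re ψ(¼+iu/2) du − m log(t/2)| ≤ K(C₀)` for `t ≥ 4`.
[cite: BalazardDeRoton2008, Prop. 12] -/
theorem abs_integral_shift_mul_reDigammaQuarter_sub_le {C C₀ : ℝ} (hC : 0 ≤ C) (hC₀ : 0 ≤ C₀)
    (hdig : ∀ t : ℝ, 4 ≤ t → ∀ u : ℝ, |reDigammaQuarter u - Real.log (t / 2)| ≤ C + 3 * Real.sqrt |u - t|)
    {F : ℝ → ℝ} (hFc : Continuous F) (hFi : Integrable F) (hF : ∀ v, |F v| ≤ C₀)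
    (hfar : ∀ v, 2 ≤ |v| → |F v| ≤ 6 / v ^ 2) {t : ℝ} (ht : 4 ≤ t) :
    |(∫ u : ℝ, F (u - t) * reDigammaQuarter u) - (∫ v, F v) * Real.log (t / 2)| ≤
      (6 * C₀ * (C + 5) + 12 * (C + 9)) * ∫ v : ℝ, ((1 + |v|) * Real.sqrt (1 + |v|))⁻¹ := by
  set A : ℝ := 6 * C₀ * (C + 5) + 12 * (C + 9) with hA
  set w : ℝ → ℝ := fun u ↦ reDigammaQuarter u - Real.log (t / 2) with hw
  -- integrability of `F(u − t) w(u)` from the majorant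
  have hmaj : ∀ u : ℝ, ‖F (u - t) * w u‖ ≤ A * ((1 + |u - t|) * Real.sqrt (1 + |u - t|))⁻¹ := by
    intro u
    rw [Real.norm_eq_abs, abs_mul]
    calc |F (u - t)| * |w u| ≤ |F (u - t)| * (C + 3 * Real.sqrt |u - t|) := by
          gcongr; exact hdig t ht u
      _ ≤ A * ((1 + |u - t|) * Real.sqrt (1 + |u - t|))⁻¹ :=
          majorant_pointwise hC hC₀ (hF _) (hfar _)
  have hint_maj : Integrable fun u : ℝ ↦ A * ((1 + |u - t|) * Real.sqrt (1 + |u - t|))⁻¹ :=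
    (integrable_inv_one_add_abs_mul_sqrt.comp_sub_right t).const_mul A
  have hcontw : Continuous w := continuous_reDigammaQuarter.sub continuous_const
  have hint1 : Integrable fun u : ℝ ↦ F (u - t) * w u :=
    Integrable.mono' hint_maj ((hFc.comp (continuous_id.sub continuous_const)).mul hcontw).aestronglyMeasurable
      (Eventually.of_forall hmaj)
  have hint2 : Integrable fun u : ℝ ↦ F (u - t) := hFi.comp_sub_right t
  -- decomposition `F(u−t) ρ(u) = F(u−t) w(u) + log(t/2) F(u−t)`
  have hdec : ∫ u : ℝ, F (u - t) * reDigammaQuarter u =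
      (∫ u : ℝ, F (u - t) * w u) + Real.log (t / 2) * ∫ u : ℝ, F (u - t) := by
    rw [← MeasureTheory.integral_const_mul, ← integral_add hint1 (hint2.const_mul _)]
    refine integral_congr_ae (Eventually.of_forall fun u ↦ ?_)
    simp only [hw]; ring
  have hshift : ∫ u : ℝ, F (u - t) = ∫ v, F v := integral_sub_right_eq_self F t
  have hkey : (∫ u : ℝ, F (u - t) * reDigammaQuarter u) - (∫ v, F v) * Real.log (t / 2) =
      ∫ u : ℝ, F (u - t) * w u := by
    simp only [hdec, hshift]
    ring
  rw [hkey]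
  calc |∫ u : ℝ, F (u - t) * w u| = ‖∫ u : ℝ, F (u - t) * w u‖ := (Real.norm_eq_abs _).symm
    _ ≤ ∫ u : ℝ, A * ((1 + |u - t|) * Real.sqrt (1 + |u - t|))⁻¹ :=
        norm_integral_le_of_norm_le hint_maj (Eventually.of_forall hmaj)
    _ = A * ∫ v : ℝ, ((1 + |v|) * Real.sqrt (1 + |v|))⁻¹ := by
        rw [MeasureTheory.integral_const_mul]
        congr 1
        exact integral_sub_right_eq_self (fun v : ℝ ↦ ((1 + |v|) * Real.sqrt (1 + |v|))⁻¹) t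

/-- **Goldston–Gonek (2.3), majorant** (case `0 < h ≤ 1`, `Δ ≥ 1`, `t ≥ 4`): with an absolute
constant `C`, `|∫ F₊(u − t) Re ψ(¼ + iu/2) du − (2h + 1/Δ) log(t/2)| ≤ C`.
[cite: BalazardDeRoton2008, Prop. 12] -/
theorem exists_abs_integral_selbergMajorant_reDigammaQuarter_sub_le :
    ∃ C : ℝ, ∀ Δ t h : ℝ, 1 ≤ Δ → 4 ≤ t → 0 < h → h ≤ 1 →
      |(∫ u : ℝ, selbergMajorantReal Δ (-h) h (u - t) * reDigammaQuarter u)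
        - (2 * h + 1 / Δ) * Real.log (t / 2)| ≤ C := by
  obtain ⟨C, hC, hdig⟩ := exists_abs_reDigammaQuarter_sub_log_half_le
  set C₀ : ℝ := 3 * Real.exp (2 * π) with hC₀
  refine ⟨(6 * C₀ * (C + 5) + 12 * (C + 9)) * ∫ v : ℝ, ((1 + |v|) * Real.sqrt (1 + |v|))⁻¹,
    fun Δ t h hΔ ht hh0 hh1 ↦ ?_⟩
  have hΔ0 : 0 < Δ := by linarith
  have hab : -h ≤ h := by linarith
  have hint := integral_selbergMajorantReal hΔ0 hab
  have hm : (2 * h + 1 / Δ) = ∫ v, selbergMajorantReal Δ (-h) h v := by rw [hint]; ring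
  rw [hm]
  exact abs_integral_shift_mul_reDigammaQuarter_sub_le hC (by positivity) hdig
    (continuous_selbergMajorantReal Δ (-h) h) (integrable_selbergMajorantReal hΔ0 hab)
    (fun v ↦ abs_selbergMajorantReal_le hΔ0 _ _ v)
    (fun v hv ↦ abs_selbergMajorantReal_le_of_two_le hΔ hh0 hh1 hv) ht

/-- **Goldston–Gonek (2.3), minorant** (case `0 < h ≤ 1`, `Δ ≥ 1`, `t ≥ 4`):
`|∫ F₋(u − t) Re ψ(¼ + iu/2) du − (2h − 1/Δ) log(t/2)| ≤ C`. [cite: BalazardDeRoton2008, Prop. 12] -/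
theorem exists_abs_integral_selbergMinorant_reDigammaQuarter_sub_le :
    ∃ C : ℝ, ∀ Δ t h : ℝ, 1 ≤ Δ → 4 ≤ t → 0 < h → h ≤ 1 →
      |(∫ u : ℝ, selbergMinorantReal Δ (-h) h (u - t) * reDigammaQuarter u)
        - (2 * h - 1 / Δ) * Real.log (t / 2)| ≤ C := by
  obtain ⟨C, hC, hdig⟩ := exists_abs_reDigammaQuarter_sub_log_half_le
  set C₀ : ℝ := 3 * Real.exp (2 * π) with hC₀
  refine ⟨(6 * C₀ * (C + 5) + 12 * (C + 9)) * ∫ v : ℝ, ((1 + |v|) * Real.sqrt (1 + |v|))⁻¹,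
    fun Δ t h hΔ ht hh0 hh1 ↦ ?_⟩
  have hΔ0 : 0 < Δ := by linarith
  have hab : -h ≤ h := by linarith
  have hint := integral_selbergMinorantReal hΔ0 hab
  have hm : (2 * h - 1 / Δ) = ∫ v, selbergMinorantReal Δ (-h) h v := by rw [hint]; ring
  rw [hm]
  exact abs_integral_shift_mul_reDigammaQuarter_sub_le hC (by positivity) hdig
    (continuous_selbergMinorantReal Δ (-h) h) (integrable_selbergMinorantReal hΔ0 hab)
    (fun v ↦ abs_selbergMinorantReal_le hΔ0 _ _ v)
    (fun v hv ↦ abs_selbergMinorantReal_le_of_two_le hΔ hh0 hh1 hv) ht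

end Literature.NumberTheory.LFunctions
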